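import Mathlib
import Summits.Ventures.HodgeRepro.Tier4.Target
import Summits.Ventures.HodgeRepro.Tier4.Line4.SeesawSigns
import Summits.Ventures.HodgeRepro.Tier4.Line4.CMPlaceBridge

/-!
# Tier4/Line4/SeesawCarry — C-L4-CARRY: the seesaw plane of two `H`-orthogonal lines is DEFINITE off `w₀` because `H` is

Blind re-derivation cell `pub-hodge-repro`, Tier 4 «prove the step» (README §9–§10), seat t4-L1-p1 g5 (prover, LINE L4
chair; plan-4 g7's cut C-L4-CARRY S16008 / S16024).  Tree path `lean/Summits/Ventures/HodgeRepro/Tier4/Line4/SeesawCarry.lean`.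
Mathlib-level; no literature; no `def`.

THE CARRYING THEOREM.  Under the seesaw dictionary `a 0 := ⟪e₁, e₁⟫_H`, `a 2 := −⟪e₂, e₂⟫_H` (both `c`-fixed, so in the
maximal real subfield `E⁺`), the plane's Gram `diag(a 0, −a 2) = diag(⟪e₁,e₁⟫, ⟪e₂,e₂⟫)` is `H` restricted to the subspace
`⟨e₁⟩ ⊕ ⟨e₂⟩ ⊂ V`; so at every infinite place `w′ ≠ w₀ = mk (τ₀ ∘ ι)` of `E⁺` the clause `SeesawDefinite q a w₀` —
`w′` real, CM, `0 < (a 0)_{w′} · (−a 2)_{w′}` — is AUTOMATIC from the target's definiteness `IsDefinite (H.map τ)` at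
the complex embeddings `τ ≠ τ₀, conj ∘ τ₀` of `E` (Target.lean L175's `hdef` shape, `IsDefinite M := M.PosDef ∨ (−M).PosDef`).

WHAT IS PROVED (sorry-free, axioms `[propext, Classical.choice, Quot.sound]`).
* `map_hform_self`: for a complex embedding `τ` of the CM field `E`, `τ ⟪x, x⟫_H = star (τ ∘ x) ⬝ᵥ (H.map τ *ᵥ (τ ∘ x))`
  (Mathlib's `IsCMField.complexEmbedding_complexConj`: `τ ∘ c = conj ∘ τ`).
* `re_map_hform_self_pos_of_posDef` / `…_neg_of_negDef`: `Re τ⟪x, x⟫_H > 0` (`< 0`) for `x ≠ 0` when `H.map τ`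
  (`−H.map τ`) is positive definite.
* **`seesawDefinite_of_orthogonal_lines`** = S16008 verbatim: `w′ ≠ w₀` lifts to an embedding `τ` of `E` with
  `τ ≠ τ₀, conjEmb τ₀` (`InfinitePlace.comap_surjective`, `comap_embedding_of_isReal`, `mk_conjugate_eq`), `hdef τ` gives
  `Re τ⟪e₁,e₁⟫` and `Re τ⟪e₂,e₂⟫` the SAME sign, and `adToC_algebraMap_eq_embedding` (SeesawSigns'
  `seesawDefinite_iff_embedding`) turns `(a 0)_{w′} · (−1 · a 2)_{w′} = τ⟪e₁,e₁⟫ · τ⟪e₂,e₂⟫ > 0` into the clause; `w′` real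
  by `isReal_of_kOf`, CM by `hcm`.  The binders `hH` (hermitian) and `horth` (orthogonality) of S16008 are carried but
  IDLE here (underscored): the sign needs only the two diagonal values and the definiteness of `H`.

Nothing here says anything about the status of the Hodge conjecture for CM abelian varieties, which is NOT proved
(HC_CM is NOT proved by anyone in this repository).
-/

set_option autoImplicit false
noncomputable section
namespace Summit.Ventures.HodgeRepro.Tier4.Line4
open Summit.Ventures.HodgeRepro.Tier4 Summit.Ventures.HodgeRepro.Tier4.Common NumberField Matrix
open scoped ComplexConjugate ComplexOrder

section Carry
variable (E : Type) [Field E] [NumberField E] [IsCMField E]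

/-- `τ ⟪x, x⟫_H = star (τ ∘ x) ⬝ᵥ (H.map τ *ᵥ (τ ∘ x))` for a complex embedding `τ` of the CM field `E`
(`c = complexConj E`, `τ ∘ c = conj ∘ τ`). -/
theorem map_hform_self (H : Matrix (Fin 3) (Fin 3) E) (τ : E →+* ℂ) (x : Fin 3 → E) :
    τ (hform (IsCMField.complexConj E).toRingEquiv H x x) =
      star (fun i => τ (x i)) ⬝ᵥ (H.map τ *ᵥ fun i => τ (x i)) := by
  unfold hform
  rw [RingHom.map_dotProduct]
  have h1 : (τ ∘ fun i => (IsCMField.complexConj E).toRingEquiv (x i)) = star (fun i => τ (x i)) := by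
    funext i
    simp only [Function.comp_apply, Pi.star_apply, AlgEquiv.coe_ringEquiv,
      IsCMField.complexEmbedding_complexConj, RCLike.star_def]
  have h2 : (τ ∘ (H *ᵥ x)) = H.map τ *ᵥ fun i => τ (x i) := by
    funext i
    exact RingHom.map_mulVec τ H x i
  rw [h1, h2]

/-- `Re τ⟪x, x⟫_H > 0` for `x ≠ 0` when `H.map τ` is positive definite. -/
theorem re_map_hform_self_pos_of_posDef (H : Matrix (Fin 3) (Fin 3) E) (τ : E →+* ℂ) (hM : (H.map τ).PosDef)
    {x : Fin 3 → E} (hx : x ≠ 0) : 0 < (τ (hform (IsCMField.complexConj E).toRingEquiv H x x)).re := by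
  have hv : (fun i => τ (x i)) ≠ 0 := by
    intro h0
    apply hx
    funext i
    exact τ.injective (by simpa using congrFun h0 i)
  have := hM.dotProduct_mulVec_pos hv
  rw [map_hform_self]
  exact (Complex.lt_def.1 this).1

/-- `Re τ⟪x, x⟫_H < 0` for `x ≠ 0` when `−H.map τ` is positive definite. -/
theorem re_map_hform_self_neg_of_negDef (H : Matrix (Fin 3) (Fin 3) E) (τ : E →+* ℂ) (hM : (-(H.map τ)).PosDef)
    {x : Fin 3 → E} (hx : x ≠ 0) : (τ (hform (IsCMField.complexConj E).toRingEquiv H x x)).re < 0 := by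
  have hv : (fun i => τ (x i)) ≠ 0 := by
    intro h0
    apply hx
    funext i
    exact τ.injective (by simpa using congrFun h0 i)
  have := hM.dotProduct_mulVec_pos hv
  rw [Matrix.neg_mulVec, dotProduct_neg] at this
  have hre := (Complex.lt_def.1 this).1
  rw [Complex.neg_re, Complex.zero_re] at hre
  rw [map_hform_self]
  linarith

/-- **C-L4-CARRY (S16008)**: with `a 0 = ⟪e₁,e₁⟫_H`, `a 2 = −⟪e₂,e₂⟫_H` (both non-zero) and `H` definite at every complex
embedding `τ ≠ τ₀, conj ∘ τ₀`, the seesaw plane is `SeesawDefinite` at `w₀ = mk (τ₀ ∘ ι)`: at every `w′ ≠ w₀` of `E⁺`,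
`w′` is real, CM, and `0 < (a 0)_{w′} · (−1 · a 2)_{w′}`. -/
theorem seesawDefinite_of_orthogonal_lines (H : Matrix (Fin 3) (Fin 3) E)
    (_hH : IsCHermitian (IsCMField.complexConj E).toRingEquiv H) (τ₀ : E →+* ℂ)
    (hdef : ∀ τ : E →+* ℂ, τ ≠ τ₀ → τ ≠ conjEmb τ₀ → IsDefinite (H.map τ))
    (q : QuadData ↥(maximalRealSubfield E)) (hcm : ∀ w, IsCMAt q w) (e₁ e₂ : Fin 3 → E)
    (_horth : hform (IsCMField.complexConj E).toRingEquiv H e₁ e₂ = 0) (a : Fin 4 → ↥(maximalRealSubfield E))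
    (ha0 : algebraMap ↥(maximalRealSubfield E) E (a 0) = hform (IsCMField.complexConj E).toRingEquiv H e₁ e₁)
    (ha2 : algebraMap ↥(maximalRealSubfield E) E (a 2) = -hform (IsCMField.complexConj E).toRingEquiv H e₂ e₂)
    (h₁ : hform (IsCMField.complexConj E).toRingEquiv H e₁ e₁ ≠ 0)
    (h₂ : hform (IsCMField.complexConj E).toRingEquiv H e₂ e₂ ≠ 0) :
    SeesawDefinite q a (InfinitePlace.mk (τ₀.comp (algebraMap ↥(maximalRealSubfield E) E))) := by
  rw [seesawDefinite_iff_embedding]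
  intro w' hw'
  refine ⟨isReal_of_kOf E w', hcm w', ?_⟩
  -- lift `w′` to an infinite place of `E`
  obtain ⟨W, hW⟩ := InfinitePlace.comap_surjective (k := ↥(maximalRealSubfield E)) (K := E) w'
  have hW' : W.comap (algebraMap ↥(maximalRealSubfield E) E) = w' := hW
  have hw'mk : w' = InfinitePlace.mk (W.embedding.comp (algebraMap ↥(maximalRealSubfield E) E)) := by
    rw [← hW', ← InfinitePlace.mk_embedding W, InfinitePlace.comap_mk, InfinitePlace.mk_embedding]
  set τ : E →+* ℂ := W.embedding with hτ
  -- `τ ≠ τ₀` and `τ ≠ conj ∘ τ₀`, else `w′ = w₀`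
  have hτ₀ : τ ≠ τ₀ := by
    intro h
    apply hw'
    rw [hw'mk, h]
  have hτ₀' : τ ≠ conjEmb τ₀ := by
    intro h
    apply hw'
    rw [hw'mk, h]
    have : (conjEmb τ₀).comp (algebraMap ↥(maximalRealSubfield E) E) =
        ComplexEmbedding.conjugate (τ₀.comp (algebraMap ↥(maximalRealSubfield E) E)) := rfl
    rw [this, InfinitePlace.mk_conjugate_eq]
  -- the embedding of `w′` is `τ ∘ ι`
  have hemb : ∀ x : ↥(maximalRealSubfield E), w'.embedding x = τ (algebraMap ↥(maximalRealSubfield E) E x) := by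
    intro x
    have h := InfinitePlace.comap_embedding_of_isReal (algebraMap ↥(maximalRealSubfield E) E)
      (w := W) (by rw [hW']; exact isReal_of_kOf E w')
    rw [hW'] at h
    rw [h]
    rfl
  have he₁ : e₁ ≠ 0 := by
    intro h0
    apply h₁
    rw [h0]
    unfold hform
    simp
  have he₂ : e₂ ≠ 0 := by
    intro h0
    apply h₂
    rw [h0]
    unfold hform
    simp
  -- the two diagonal values at `τ`
  have hA0 : w'.embedding (a 0) = τ (hform (IsCMField.complexConj E).toRingEquiv H e₁ e₁) := by
    rw [hemb, ha0]
  have hA2 : w'.embedding (-1 * a 2) = τ (hform (IsCMField.complexConj E).toRingEquiv H e₂ e₂) := by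
    rw [hemb]
    congr 1
    rw [map_mul, map_neg, map_one, ha2, neg_one_mul, neg_neg]
  rw [hA0, hA2]
  rcases hdef τ hτ₀ hτ₀' with hpos | hneg
  · exact mul_pos (re_map_hform_self_pos_of_posDef E H τ hpos he₁)
      (re_map_hform_self_pos_of_posDef E H τ hpos he₂)
  · exact mul_pos_of_neg_of_neg (re_map_hform_self_neg_of_negDef E H τ hneg he₁)
      (re_map_hform_self_neg_of_negDef E H τ hneg he₂)

end Carry

end Summit.Ventures.HodgeRepro.Tier4.Line4

end
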